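import Mathlib.Algebra.BigOperators.Group.Finset.Basic
import Mathlib.Algebra.Ring.Parity
import Mathlib.Data.ZMod.Basic
import Mathlib.Tactic.Linarith
import Mathlib.Tactic.NormNum
import Mathlib.Tactic.Ring
import Mathlib.Tactic.IntervalCases
import Mathlib.Tactic.FieldSimp
import Mathlib.Tactic.LinearCombination
import HarnessLib

/-!
# The (0,1) cell of the ι-window, XV: the product ground `B₁ × B₂`, II — the FIXED-POINT BUDGET on an abelian surface, the EISENSTEIN
# parametrisation of all two-term box decompositions of the H2 class, the t-SEPARATION lemma, and the arithmetic of THEOREM PB2 — algebraic skeleton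

Family `hodge`, b2b cell `hweil` (helper of item stmt-HodgeConjecture-2524). Report
`run/shared/lean/b2b/hodge-weil/b2b-hweil-pv1-g27/H2-ZERO-ONE-15.md` (prover 1 gen 27). Companion to `WeilTypeLadderH2EvenBranchVoid.lean` (gen 25:
THEOREM PB1, the rank-(1,1) box family, `pb_*`). HONEST FRAMING: census results inside the ladder's H2 test ((0,1) cell) on the SPECIAL fourfold
`X₀ = B₁ × B₂` (product of two very general principally polarised abelian surfaces); by the cell's THEOREM U5 an object there would decide H2
positively, while emptiness of a family there is a census line and nothing more. No case of the Hodge conjecture is proved; nothing here is a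
rung; no statement of [Markman 2025] / [Perry 2026] / [EdGFS 2025] is used. The kernel content is the elementary arithmetic and linear algebra
of the report; the geometry (holomorphic Lefschetz at the 16 isolated fixed points of `−1` on an abelian surface, Mukai's `χ(E,E) = −v²` and the
smoothness / symplectic structure of `Spl_B(v)`, Serre duality, Künneth, Fourier–Mukai) is quoted print and the cell's certified items.

## LEMMA FB (fixed-point budget; report §1)

`B` an abelian surface, `ι = −1_B`, `E` a SIMPLE `ι`-invariant sheaf (or perfect complex) with Mukai vector `v`, `v² > 0`, linearised, local
indices `t_x ∈ ℤ` at the 16 points of `B[2]`. Holomorphic Lefschetz for `R𝓗om(E,E)` (`det(1 − dι) = 4`, local supertrace `t_x²`) and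
`e₀^ι = e₂^ι = 1` (Serre duality; `ι = +1` on `H^{0,2}`) give **`e₁^ι(E) = 2 + v²/2 − Σ_x t_x²/8`** (`pgt_budget`); `e₁^ι` is EVEN (Mukai's form on
`Ext¹(E,E)` is `ι`-invariant, so its `+1`-eigenspace is symplectic), whence `Σ t_x² ≡ 4v² (mod 16)` (`pgt_budget_parity`); and
`0 ≤ e₁^ι ≤ v² − 2` (the `B × B̂`-orbit directions are anti-invariant). Consequences: `v² = 2` ⟹ `Σt² = 24`, `e₁^ι = 0` (`pgt_norm_one_forced`);
`v² = 6` ⟹ `(Σt², e₁^ι) ∈ {(40,0),(24,2),(8,4)}` (`pgt_norm_three_cases`; `(8,4)` is excluded geometrically); `v² = 8`, `t ≡ 0` ⟹ `e₁^ι = 6`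
(`pgt_norm_four_balanced`).

## The Eisenstein parametrisation (report §2)

On a v.g. ppas the integral classes `u = (r, cθ, s·p)` lying in the `ℚ(√−3)`-secant plane of the H2 class are `{r + c + s = 0}` (reading
`v = 2 − θ² + θ³/3`) resp. `{s = c − r}` (reading `2w₀ = 2θ + θ² − θ⁴/12`), with `u² = 2(r² ± rc + c²)` — twice an Eisenstein norm. EVERY
two-term box decomposition `u₁ ⊠ u₂ + u₁′ ⊠ u₂′` of the H2 class is obtained from an arbitrary pair `(u₂, u₂′)` of area `k := r₂c₂′ − c₂r₂′ ≠ 0`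
by the universal identities `pgt_two_term_identity_v` / `pgt_two_term_identity_w` (`2·(u₁ ⊠ u₂ + u₁′ ⊠ u₂′) = k·V` with `u₁, u₁′` the explicit
rotated conjugates), so `|η₁| = 2|η₂′|/|k|`, `|η₁′| = 2|η₂|/|k|` for the Eisenstein integers `η` labelling the classes; `2` and `10` are not
Eisenstein norms (`pgt_no_norm_two`, `pgt_no_norm_ten`).

## t-SEPARATION (report §3) and the arithmetic of THEOREM PB2 (report §4)

`t(F) = t(A₁) ⊗ t(A₂) + t(B₁) ⊗ t(B₂) ≡ 0` on `B₁[2] × B₂[2]` forces (`pgt_separation`, `pgt_separation_cor`): either both 'big' factors are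
BALANCED, or each big factor's index vector is a rational multiple `μ` of its unit partner's. With FB this pins `(μ, e₁^ι)`:
norm 3 ⟹ `μ = ±1, e₁^ι = 2` (`pgt_cross_norm_three_mu`); norm 4 in CROSS position ⟹ impossible (`pgt_cross_norm_four_void`); norm 7 ⟹ `μ = ±1,
e₁^ι = 6` (`pgt_cross_norm_seven_mu`); norm 12 ⟹ `μ = ±2, e₁^ι = 2` or balanced (`pgt_cross_norm_twelve_mu`). The Mukai pairings and the expected
dimensions `ε` of the two-term families are `pgt_pairings`, `pgt_epsilon`.
-/

-- mandated namespace `Summit.HodgeConjecture.HodgeConjecture.…` (Problem = Summit) trips `linter.dupNamespace`; the lakefile disables it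
-- tree-wide (weak option), restated here so stand-alone elaboration is warning-free too.
set_option linter.dupNamespace false

namespace Summit.HodgeConjecture.HodgeConjecture.WeilTypeLadder

section ProductGroundTwo

/-- **LEMMA FB (fixed-point budget on an abelian surface; report §1.1).** For a simple `ι`-invariant object `E` on an abelian surface with
Mukai vector `v` and local indices `t_x` at the 16 fixed points: holomorphic Lefschetz for `R𝓗om(E,E)` reads
`e₀^ι − e₁^ι + e₂^ι = ½(χ(E,E) + Σ_x t_x²/4)` with `χ(E,E) = −v²` (Mukai) and `e₀^ι = e₂^ι = 1` (simplicity + Serre duality, `ι = +1` on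
`H^{0,2}`); hence `e₁^ι = 2 + v²/2 − Σt²/8`. [new; the geometric inputs are the cell's certified holomorphic-Lefschetz tool and Mukai 1984] -/
theorem pgt_budget (v2 st e1 : ℚ) (h : 1 - e1 + 1 = (1 / 2) * (-v2 + st / 4)) : e1 = 2 + v2 / 2 - st / 8 := by
  linarith

/-- **FB, parity form (report §1.1 (ii)).** In integers: `8e₁ = 16 + 4v² − Σt²`; if `e₁` is even (the `+1`-eigenspace of Mukai's
`ι`-invariant symplectic form on `Ext¹(E,E)` is symplectic) then `Σt² ≡ 4v² (mod 16)`. [new] -/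
theorem pgt_budget_parity (v2 st e1 : ℤ) (h : 8 * e1 = 16 + 4 * v2 - st) (hev : Even e1) : (16 : ℤ) ∣ 4 * v2 - st := by
  obtain ⟨m, hm⟩ := hev
  exact ⟨m - 1, by linarith⟩

/-- **FB at `v² = 2` (report §1.2 (a)): unit classes are rigid and carry `Σt² = 24`.** `Spl_B(v)` is a single `B × B̂`-orbit (dimension
`v² + 2 = 4`), whose tangent directions are `ι`-anti-invariant, so `e₁^ι = 0`; the budget then forces `Σ_x t_x² = 24` — e.g. `𝓘_w`
(`9 + 15·1`) and `𝒪_C(ξ)` on a symmetric theta curve (`6·4`). [new] -/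
theorem pgt_norm_one_forced (st e1 : ℤ) (h : 8 * e1 = 16 + 4 * 2 - st) (h0 : 0 ≤ e1) (h1 : e1 ≤ 2 - 2) :
    st = 24 ∧ e1 = 0 ∧ (9 : ℤ) + 15 * 1 = 24 ∧ (6 : ℤ) * 4 = 24 := by
  refine ⟨by omega, by omega, by norm_num, by norm_num⟩

/-- **FB at `v² = 6` (report §1.2 (b)): norm-3 classes.** With `0 ≤ e₁^ι ≤ v² − 2 = 4` and `e₁^ι` even, `8e₁ = 40 − Σt²` leaves exactly
`(Σt², e₁^ι) ∈ {(40,0), (24,2), (8,4)}`; geometrically `(8,4)` would be a whole `(det, alb)`-fibre fixed by `ι`, which the generalized-Kummer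
fibre `K₂` (`Z ↦ −Z`) is not, so norm-3 objects are either RIGID with `Σt² = 40` (three half-periods) or move in the 2-dimensional Kummer
family with `Σt² = 24`. [new] -/
theorem pgt_norm_three_cases (st e1 : ℤ) (h : 8 * e1 = 16 + 4 * 6 - st) (h0 : 0 ≤ e1) (h1 : e1 ≤ 6 - 2) (hev : Even e1) :
    (st = 40 ∧ e1 = 0) ∨ (st = 24 ∧ e1 = 2) ∨ (st = 8 ∧ e1 = 4) := by
  obtain ⟨m, hm⟩ := hev
  have hm0 : 0 ≤ m := by omega
  have hm1 : m ≤ 2 := by omega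
  interval_cases m <;> omega

/-- **FB at `v² = 8`, balanced (report §1.2 (c)).** A simple `ι`-invariant sheaf in a norm-4 class (`v = 2·unit`, `v² = 8`) with ALL sixteen
local indices zero has `e₁^ι = 6 = dim` of the `(det, alb)`-fibre of `Spl_B(v)`: balanced norm-4 objects fill whole `ι`-FIXED fibre
components (PROPOSITION OG of the report: e.g. `i_*N`, `N ∈ Pic²(D)`, `D ∈ |2Θ|` smooth, and their Fourier–Mukai transforms). [new] -/
theorem pgt_norm_four_balanced (e1 : ℤ) (h : 8 * e1 = 16 + 4 * 8 - 0) : e1 = 6 ∧ e1 = 8 + 2 - 4 := by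
  omega

/-- **t-SEPARATION (report §3.1).** If `a ⊗ b + a′ ⊗ b′ = 0` as a matrix on `B₁[2] × B₂[2]` and `b` has a non-zero entry, then `a = λ·a′`
for the scalar `λ = −b′_{j₀}/b_{j₀}` and `a′_i (λ b_j + b′_j) = 0` for all `i, j`. Applied to `t(F) = t(A₁)⊗t(A₂) + t(B₁)⊗t(B₂)` for a
two-term box extension. [new; linear algebra] -/
theorem pgt_separation {I J : Type*} (a a' : I → ℚ) (b b' : J → ℚ) (h : ∀ i j, a i * b j + a' i * b' j = 0) (j₀ : J)
    (hb : b j₀ ≠ 0) : ∃ l : ℚ, (∀ i, a i = l * a' i) ∧ ∀ i j, a' i * (l * b j + b' j) = 0 := by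
  refine ⟨-(b' j₀) / b j₀, ?_, ?_⟩
  · intro i
    have hi := h i j₀
    field_simp
    linarith
  · intro i j
    have hi := h i j₀
    have hij := h i j
    have hai : a i = -(b' j₀) / b j₀ * a' i := by
      field_simp
      linarith
    rw [hai] at hij
    have : a' i * (-(b' j₀) / b j₀ * b j + b' j) = -(b' j₀) / b j₀ * a' i * b j + a' i * b' j := by ring
    rw [this]
    exact hij

/-- **t-SEPARATION, dichotomy (report §3.1).** In the situation of `pgt_separation`: if moreover `a′` has a non-zero entry then
`b′ = −λ·b`. Hence, with `a = t(unit on B₁) ≠ 0` and `b′ = t(unit on B₂) ≠ 0` (units have `Σt² = 24`): EITHER `λ`… concretely, either both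
big factors are balanced (`b = 0`, forcing `a′ = 0`), or `t(big) = μ·t(unit partner)` on each surface with `μ ≠ 0` rational. [new] -/
theorem pgt_separation_cor {I J : Type*} (a' : I → ℚ) (b b' : J → ℚ) (l : ℚ) (h : ∀ i j, a' i * (l * b j + b' j) = 0) (i₀ : I)
    (ha : a' i₀ ≠ 0) : ∀ j, b' j = -l * b j := by
  intro j
  have := h i₀ j
  rcases mul_eq_zero.mp this with h1 | h1
  · exact absurd h1 ha
  · linarith

/-- **Norm-3 big factors (report §4.2, Type II₃).** In CROSS position a norm-3 factor `E` (`v² = 6`) has `t(E) = μ·t(u)` for its unit partner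
`u` (`Σt(u)² = 24`); write `μ = m/2` (`m ∈ ℤ`, half-integers allowed for curve-type units). FB: `4e₁ = 20 − 3m²` with `e₁` even and `≥ 0`
forces `m = ±2`, i.e. `μ = ±1` and `e₁^ι(E) = 2` — the Kummer family; balanced (`m = 0`) is impossible (`e₁ = 5` odd). [new] -/
theorem pgt_cross_norm_three_mu (m e : ℤ) (h : 4 * e = 20 - 3 * m ^ 2) (hev : Even e) (h0 : 0 ≤ e) : m ^ 2 = 4 ∧ e = 2 := by
  obtain ⟨n, hn⟩ := hev
  have hb : m ≤ 2 ∧ -2 ≤ m := by constructor <;> nlinarith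
  obtain ⟨hb1, hb2⟩ := hb
  interval_cases m <;> omega

/-- **Norm-4 big factors in CROSS position are impossible (report §4.2, Type II₄).** `4e₁ = 24 − 3m²` with `m ≠ 0` (cross position forces
`μ ≠ 0`), `e₁` even, `e₁ ≥ 0` has no solution: `m = ±1` gives `4e₁ = 21`, `m = ±2` gives `e₁ = 3`. So the t-balance equation of every
cross-type two-term family with norm-4 big factors (e.g. `𝒪_{C₁}(K) ⊠ (2,0,−2) + (2,2,0) ⊠ 𝒪_{C₂}(K)`) is unsatisfiable. [new] -/
theorem pgt_cross_norm_four_void (m e : ℤ) (h : 4 * e = 24 - 3 * m ^ 2) (hm : m ≠ 0) (hev : Even e) (h0 : 0 ≤ e) : False := by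
  obtain ⟨n, hn⟩ := hev
  have hb : m ≤ 2 ∧ -2 ≤ m := by constructor <;> nlinarith
  obtain ⟨hb1, hb2⟩ := hb
  interval_cases m <;> omega

/-- **Norm-7 big factors (report §4.2, Type II₇).** `4e₁ = 36 − 3m²`, `e₁` even, `≥ 0` ⟹ `m = ±2`, `e₁^ι = 6`. [new] -/
theorem pgt_cross_norm_seven_mu (m e : ℤ) (h : 4 * e = 36 - 3 * m ^ 2) (hev : Even e) (h0 : 0 ≤ e) : m ^ 2 = 4 ∧ e = 6 := by
  obtain ⟨n, hn⟩ := hev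
  have hb : m ≤ 3 ∧ -3 ≤ m := by constructor <;> nlinarith
  obtain ⟨hb1, hb2⟩ := hb
  interval_cases m <;> omega

/-- **Norm-12 big factors (report §4.2, Type II₁₂).** `4e₁ = 56 − 3m²`, `e₁` even, `≥ 0` ⟹ `m = 0` (balanced, `e₁ = 14`; excluded in cross
position) or `m = ±4` (`μ = ±2`, `e₁^ι = 2`): the over-determined residual type of THEOREM PB2. [new] -/
theorem pgt_cross_norm_twelve_mu (m e : ℤ) (h : 4 * e = 56 - 3 * m ^ 2) (hev : Even e) (h0 : 0 ≤ e) :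
    (m = 0 ∧ e = 14) ∨ (m ^ 2 = 16 ∧ e = 2) := by
  obtain ⟨n, hn⟩ := hev
  have hb : m ≤ 4 ∧ -4 ≤ m := by constructor <;> nlinarith
  obtain ⟨hb1, hb2⟩ := hb
  interval_cases m <;> omega

/-- **The universal two-term identity, reading `v = 2 − θ² + θ³/3` (report §2.3).** Classes `(r, cθ, sp)` with `s = −r − c` (the factor secant
plane); for ANY `(r₂,c₂), (r₂′,c₂′)` put `k := r₂c₂′ − c₂r₂′`, `u₁ := (c₂′, r₂′, −r₂′−c₂′)`, `u₁′ := (−c₂, −r₂, r₂+c₂)`. Then, entry by entry in the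
basis `(1,θ₁,p₁) ⊗ (1,θ₂,p₂)`, `2·(u₁ ⊠ u₂ + u₁′ ⊠ u₂′) = k·V` with `V = [[2,0,−2],[0,−2,2],[−2,2,0]]` the matrix of the H2 class. Instances: `k = 2`
with `u₂ = 𝓘_w(−Θ) = (1,−1,0)`, `u₂′ = 𝓘_Z(Θ) = (1,1,−2)` is THEOREM PB1's pair; all 41 window solutions of `box2.py` are instances. [new] -/
theorem pgt_two_term_identity_v (r₂ c₂ r₂' c₂' : ℤ) :
    2 * (c₂' * r₂ + (-c₂) * r₂') = (r₂ * c₂' - c₂ * r₂') * 2 ∧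
    2 * (c₂' * c₂ + (-c₂) * c₂') = (r₂ * c₂' - c₂ * r₂') * 0 ∧
    2 * (c₂' * (-r₂ - c₂) + (-c₂) * (-r₂' - c₂')) = (r₂ * c₂' - c₂ * r₂') * (-2) ∧
    2 * (r₂' * r₂ + (-r₂) * r₂') = (r₂ * c₂' - c₂ * r₂') * 0 ∧
    2 * (r₂' * c₂ + (-r₂) * c₂') = (r₂ * c₂' - c₂ * r₂') * (-2) ∧
    2 * (r₂' * (-r₂ - c₂) + (-r₂) * (-r₂' - c₂')) = (r₂ * c₂' - c₂ * r₂') * 2 ∧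
    2 * ((-r₂' - c₂') * r₂ + (r₂ + c₂) * r₂') = (r₂ * c₂' - c₂ * r₂') * (-2) ∧
    2 * ((-r₂' - c₂') * c₂ + (r₂ + c₂) * c₂') = (r₂ * c₂' - c₂ * r₂') * 2 ∧
    2 * ((-r₂' - c₂') * (-r₂ - c₂) + (r₂ + c₂) * (-r₂' - c₂')) = (r₂ * c₂' - c₂ * r₂') * 0 := by
  refine ⟨by ring, by ring, by ring, by ring, by ring, by ring, by ring, by ring, by ring⟩

/-- **The universal two-term identity, reading `2w₀ = 2θ + θ² − θ⁴/12` (rank 0, `c₁ = 2θ`: sheaves of rank 2 on the theta divisor;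
report §2.3).** Plane `s = c − r`; `u₁ := (−r₂′, c₂′ − r₂′, c₂′)`, `u₁′ := (r₂, r₂ − c₂, −c₂)`; `2·(u₁ ⊠ u₂ + u₁′ ⊠ u₂′) = k·W` with
`W = [[0,2,2],[2,2,0],[2,0,−2]]`. Instance `k = 2`, `u₂ = (2,1,−1)`, `u₂′ = (0,1,1) = 𝒪_{C}(K_C)`: the symmetric pair
`𝒪_{C₁}(K) ⊠ E₂ + E₁ ⊠ 𝒪_{C₂}(K)` of report §4.3 (= PB1's class pair read through `Φ`). [new] -/
theorem pgt_two_term_identity_w (r₂ c₂ r₂' c₂' : ℤ) :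
    2 * ((-r₂') * r₂ + r₂ * r₂') = (r₂ * c₂' - c₂ * r₂') * 0 ∧
    2 * ((-r₂') * c₂ + r₂ * c₂') = (r₂ * c₂' - c₂ * r₂') * 2 ∧
    2 * ((-r₂') * (c₂ - r₂) + r₂ * (c₂' - r₂')) = (r₂ * c₂' - c₂ * r₂') * 2 ∧
    2 * ((c₂' - r₂') * r₂ + (r₂ - c₂) * r₂') = (r₂ * c₂' - c₂ * r₂') * 2 ∧
    2 * ((c₂' - r₂') * c₂ + (r₂ - c₂) * c₂') = (r₂ * c₂' - c₂ * r₂') * 2 ∧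
    2 * ((c₂' - r₂') * (c₂ - r₂) + (r₂ - c₂) * (c₂' - r₂')) = (r₂ * c₂' - c₂ * r₂') * 0 ∧
    2 * (c₂' * r₂ + (-c₂) * r₂') = (r₂ * c₂' - c₂ * r₂') * 2 ∧
    2 * (c₂' * c₂ + (-c₂) * c₂') = (r₂ * c₂' - c₂ * r₂') * 0 ∧
    2 * (c₂' * (c₂ - r₂) + (-c₂) * (c₂' - r₂')) = (r₂ * c₂' - c₂ * r₂') * (-2) := by
  refine ⟨by ring, by ring, by ring, by ring, by ring, by ring, by ring, by ring, by ring⟩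

/-- **`2` is not an Eisenstein norm (report §2.2).** `r² + rc + c² ≢ 2 (mod 3)` since it is `(r − c)² (mod 3)`. Used: no norm-2 class exists,
so two non-parallel units have area `±1` exactly and the smallest big norms are `3, 4, 7`. [new] -/
theorem pgt_no_norm_two (r c : ℤ) : r ^ 2 + r * c + c ^ 2 ≠ 2 := by
  intro h
  have key : ∀ x y : ZMod 3, x ^ 2 + x * y + y ^ 2 ≠ 2 := by decide
  apply key (r : ZMod 3) (c : ZMod 3)
  have := congrArg (fun z : ℤ => (z : ZMod 3)) h
  push_cast at this
  exact this

/-- **`10` is not an Eisenstein norm (report §2.2).** Mod 5 the form `x² + xy + y²` is anisotropic, so `5 ∣ r² + rc + c²` forces `5 ∣ r, c`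
and then `25 ∣ 10`. Used: `e₁^ι = 2 + n − 3μ²` never VANISHES for a proportional big factor of norm `n > 1` with `μ = ±2` (`n = 10`).
[new] -/
theorem pgt_no_norm_ten (r c : ℤ) : r ^ 2 + r * c + c ^ 2 ≠ 10 := by
  intro h
  have key : ∀ x y : ZMod 5, x ^ 2 + x * y + y ^ 2 = 0 → x = 0 ∧ y = 0 := by decide
  have h5 : ((r : ZMod 5)) ^ 2 + (r : ZMod 5) * (c : ZMod 5) + (c : ZMod 5) ^ 2 = 0 := by
    have := congrArg (fun z : ℤ => (z : ZMod 5)) h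
    push_cast at this
    rw [this]
    decide
  obtain ⟨hr, hc⟩ := key _ _ h5
  rw [ZMod.intCast_zmod_eq_zero_iff_dvd] at hr hc
  obtain ⟨a, ha⟩ := hr
  obtain ⟨b, hb⟩ := hc
  subst ha hb
  have h' : 25 * (a ^ 2 + a * b + b ^ 2) = 10 := by linear_combination h
  generalize a ^ 2 + a * b + b ^ 2 = n at h'
  omega

/-- **Mukai pairings used in the two-term table (report §4.3).** `⟨(r,c,s),(r′,c′,s′)⟩ = 2cc′ − rs′ − r′s` (`θ² = 2`), `χ(E,F) = −⟨v(E),v(F)⟩`: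
the unit–big pairings `⟨(2,1,−1),(0,1,1)⟩ = 0` (norm 3: `χ = 0`, the gluing conditions are χ-balanced), `⟨(2,3,1),(0,1,1)⟩ = 4`,
`⟨(2,−1,−3),(0,1,1)⟩ = −4` (norm 7), `⟨(2,4,2),(0,1,1)⟩ = 6`, `⟨(2,−2,−4),(0,1,1)⟩ = −6` (norm 12), and `⟨(0,2,2),(2,0,−2)⟩ = −4`,
`⟨(1,1,0),(0,1,1)⟩ = 1`, `⟨(1,0,−1),(0,1,1)⟩ = −1` (parallel norm-4 type). [new] -/
theorem pgt_pairings :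
    (2 : ℤ) * 1 * 1 - 2 * 1 - 0 * (-1) = 0 ∧ (2 : ℤ) * 3 * 1 - 2 * 1 - 0 * 1 = 4 ∧ (2 : ℤ) * (-1) * 1 - 2 * 1 - 0 * (-3) = -4 ∧
    (2 : ℤ) * 4 * 1 - 2 * 1 - 0 * 2 = 6 ∧ (2 : ℤ) * (-2) * 1 - 2 * 1 - 0 * (-4) = -6 ∧ (2 : ℤ) * 2 * 0 - 0 * (-2) - 2 * 2 = -4 ∧
    (2 : ℤ) * 1 * 1 - 1 * 1 - 0 * 0 = 1 ∧ (2 : ℤ) * 0 * 1 - 1 * 1 - 0 * (-1) = -1 := by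
  refine ⟨by norm_num, by norm_num, by norm_num, by norm_num, by norm_num, by norm_num, by norm_num, by norm_num⟩

/-- **Expected dimensions `ε` of the two-term families (report §4.4).** `ε = Σ_i (e₁^ι(big_i) − c_i)` with `c_i ≤ max(0, 1 − χ_i)` the
Brill–Noether codimension bound of the gluing condition: norm 3 (PB1 pair: no condition) `2 + 2 − 0 − 0 = 4 ≥ 2`; parallel norm 4:
`6 + 6 − 5 − 0 = 7 ≥ 2`; cross norm 7: `(6 − 5) + (6 − 5) = 2 ≥ 2`; cross norm 12: `(2 − 7) + (2 − 7) = −10 < 0` (over-determined residual).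
[new; bookkeeping] -/
theorem pgt_epsilon :
    (2 : ℤ) + 2 - 0 - 0 = 4 ∧ (6 : ℤ) + 6 - 5 - 0 = 7 ∧ ((6 : ℤ) - 5) + (6 - 5) = 2 ∧ ((2 : ℤ) - 7) + (2 - 7) = -10 ∧
    (1 : ℤ) - (-4) = 5 ∧ (1 : ℤ) - (-6) = 7 := by
  refine ⟨by norm_num, by norm_num, by norm_num, by norm_num, by norm_num, by norm_num⟩

end ProductGroundTwo

section ProductGroundTwoAddendum

/-!
### ADDENDUM (report §4.3 (V), same seat): the crudely over-determined type [1,12,12,1] is VOID — a rank-2 factor with |t| = 4 is singular on the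
### theta curve, which forces the gluing Ext¹; the invariant family is the Kummer surface Km(B̂)
-/

/-- **Local index of a finite-length equivariant module (report §4.2 (V)).** Every `k(x) ⊗ χ` in a composition series of a finite-length `ι`-module
`Q` at a fixed point of `−1` on a surface contributes `4χ` (Koszul: `1 − (−2) + 1`), so `t(Q) = 4(n₊ − n₋) ∈ 4ℤ`. [new; bookkeeping] -/
theorem pgt_quotient_index_mult_four (np nm : ℤ) : (4 : ℤ) ∣ 4 * np - 4 * nm ∧ (1 : ℤ) - (-2) + 1 = 4 :=
  ⟨⟨np - nm, by ring⟩, by norm_num⟩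

/-- **A rank-2 torsion-free sheaf with `|t_x| = 4` is NOT locally free at `x` (report §4.2 (V)).** `t(E) = t(E′) − t(Q)` with `E′ = E^{∨∨}` locally free
(`t(E′)_x = a + b`, `a, b = ±1` the fibre eigenvalues) and `4 ∣ t(Q_x)`; `t_x(E) = ±4` forces `a + b = 0` (the hull is BALANCED at `x`) and `t(Q_x) ≠ 0`
(so `Q_x ≠ 0`: `E` is singular at `x`). [new] -/
theorem pgt_rank_two_forces_singular (a b tQ : ℤ) (ha : a = 1 ∨ a = -1) (hb : b = 1 ∨ b = -1) (hQ : (4 : ℤ) ∣ tQ)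
    (h : a + b - tQ = 4 ∨ a + b - tQ = -4) : a + b = 0 ∧ tQ ≠ 0 := by
  obtain ⟨q, hq⟩ := hQ
  rcases ha with rfl | rfl <;> rcases hb with rfl | rfl <;> rcases h with h | h <;> omega

/-- **Type (V), side 2 (report §4.3 (V)): the gluing Ext¹ is forced.** For `E₂` of class `(2,−2θ,−4p)` singular at the six half-periods of `C₂`:
`G₂ = E₂|_{C₂}/torsion` has degree `−6 − 4 = −10`, so `hom(E₂, 𝒪_{C₂}(K)) = h⁰(G₂^∨ ⊗ K) = 14 + 2(1 − 2) = 12` (Riemann–Roch, degree `14 > 4`),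
`ext¹ = h⁰(G₂) + 6 = 6` (six local summands), `ext² = 0`, and `12 − 6 + 0 = 6 = −⟨(2,−2,−4),(0,1,1)⟩` — Mukai's pairing is matched EXACTLY, so
`Ext¹(𝒪_{C₂}(K), E₂) ≅ Ext¹(E₂, 𝒪_{C₂}(K))^∨` is 6-dimensional for EVERY member: the condition is empty. [new; bookkeeping] -/
theorem pgt_type_twelve_side_two :
    (-6 : ℤ) - 4 = -10 ∧ (10 : ℤ) + 4 = 14 ∧ (14 : ℤ) + 2 * (1 - 2) = 12 ∧ (0 : ℤ) + 6 = 6 ∧ (12 : ℤ) - 6 + 0 = 6 ∧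
    (2 : ℤ) * (-2) * 1 - 2 * 1 - 0 * (-4) = -6 := by
  refine ⟨by norm_num, by norm_num, by norm_num, by norm_num, by norm_num, by norm_num⟩

/-- **Type (V), side 1 (report §4.3 (V)): a codimension-≤ 1 condition.** For `E₁` of class `(2,4θ,2p)`: `G₁ = E₁|_{C₁}/torsion` has degree
`−6 + 8 = 2`, `χ(G₁^∨ ⊗ K) = 2 + 2(1 − 2) = 0`, so `hom(E₁, 𝒪_{C₁}(K)) = h =: h⁰(G₁^∨K)`, `ext¹ = h + 6`, and `h − (h + 6) + 0 = −6 = −⟨(2,4,2),(0,1,1)⟩`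
for every `h` — Mukai matched; the condition `h ≥ 1` is the vanishing of a `6 × 6` determinant (`3 + 3` sections against six eigenline conditions).
[new; bookkeeping] -/
theorem pgt_type_twelve_side_one (h : ℤ) :
    (-6 : ℤ) + 2 * 4 = 2 ∧ (2 : ℤ) + 2 * (1 - 2) = 0 ∧ h - (h + 6) + 0 = -6 ∧ (4 : ℤ) - 2 + 1 = 3 ∧ (3 : ℤ) + 3 = 6 := by
  refine ⟨by norm_num, by norm_num, by ring, by norm_num, by norm_num⟩

/-- **Type (V) is VOID (report §4.3 (V)).** The free factor `E₂` ranges over a 2-dimensional invariant family (FB: `e₁^ι = 2 + 12 − 96/8 = 2`; the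
Kummer surface `Km(B̂)` of hulls `P ⊕ P^{−1}`), the gluing space has dimension `hom(E₁,u₁)·6 ≥ 6`, so the candidates through any `F` form a family of
dimension `≥ 2 + (6 − 1) = 7 ≥ 2` (original order) resp. `≥ 2 + 2 + (6·12 − 1) = 75` (reversed order): `e₁^ι(F) ≥ 2`, replacing the crude
`ε = −10` of `pgt_epsilon`. [new; bookkeeping] -/
theorem pgt_type_twelve_void : (2 : ℚ) + 12 - 96 / 8 = 2 ∧ (2 : ℤ) + (6 - 1) = 7 ∧ (7 : ℤ) ≥ 2 ∧ (2 : ℤ) + 2 + (6 * 12 - 1) = 75 := by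
  refine ⟨by norm_num, by norm_num, by norm_num, by norm_num⟩

end ProductGroundTwoAddendum

section ProductGroundTwoAddendumTwo

/-!
### ADDENDUM 2 (report §11, same seat): three-piece typology (the twist-pair obstruction), LEMMA IC / EXAMPLE IC bookkeeping
-/

/-- **Twist-pair obstruction (report §11.1).** If a class `u` of the secant plane and its twist `u·e^{2mθ}` (`m ≠ 0`) both lie in the plane, then
`u = (2r′, r′(1 ∓ 2m), ·)`, `N(u) = r′²(3 + 4m²)` and the area is `k = 8mr′²`, so the Eisenstein partner would have norm `4N/k² = (3 + 4m²)/(16m²r′²)`: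
an odd number is not divisible by an even one (for `m = 0` the statement is `¬ 0 ∣ 3`), so no such two-term (or 'split' three-piece) family
exists. [new] -/
theorem pgt_twist_pair_obstruction (m r' : ℤ) : ¬ (16 * m ^ 2 * r' ^ 2 ∣ 3 + 4 * m ^ 2) := by
  rintro ⟨q, hq⟩
  have h2 : (2 : ℤ) ∣ 3 + 4 * m ^ 2 := ⟨8 * m ^ 2 * r' ^ 2 * q, by linarith⟩
  omega

/-- **EXAMPLE IC, the class (report §11.3 (ii)).** In the basis `(1,θ₁,p₁) ⊗ (1,θ₂,p₂)`: `ch 𝓘_{S′} = 1 − p₁ − p₂ + p₁p₂` for the two planes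
`{q} × B₂ ∪ B₁ × {r}` meeting at one point (matrix `[[1,0,−1],[0,0,0],[−1,0,1]]`), `ch 𝒪_Σ = (θ₁ − p₁)(θ₂ − p₂)` for the translate `Σ` of the product of
the theta curves (matrix `[[0,0,0],[0,1,−1],[0,−1,1]]`), and `2·ch 𝓘_{S′} − 2·ch 𝒪_Σ = V = [[2,0,−2],[0,−2,2],[−2,2,0]]`, the H2 class `2 − θ² + θ³/3`:
the nine entries. [new; bookkeeping] -/
theorem pgt_example_ic_class :
    (2 : ℤ) * 1 - 2 * 0 = 2 ∧ (2 : ℤ) * 0 - 2 * 0 = 0 ∧ (2 : ℤ) * (-1) - 2 * 0 = -2 ∧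
    (2 : ℤ) * 0 - 2 * 0 = 0 ∧ (2 : ℤ) * 0 - 2 * 1 = -2 ∧ (2 : ℤ) * 0 - 2 * (-1) = 2 ∧
    (2 : ℤ) * (-1) - 2 * 0 = -2 ∧ (2 : ℤ) * 0 - 2 * (-1) = 2 ∧ (2 : ℤ) * 1 - 2 * 1 = 0 := by
  refine ⟨by norm_num, by norm_num, by norm_num, by norm_num, by norm_num, by norm_num, by norm_num, by norm_num, by norm_num⟩

/-- **LEMMA IC (d), the gluing count for transversal box curves (report §11.2).** On `B₁`, `Ext^i(k(p), 𝒪_{D₁}(M₁)) = (0,1,1)` for `p ∈ D₁` (dual to the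
fibre and the first Tor of a curve sheaf); on `B₂`, `Ext^j(𝒪_{D₂}(M₂), k(q)) = (1,1,0)` for `q ∈ D₂`; Künneth convolution gives
`Ext^•_{X₀}(𝒪_{{p}×D₂}(M₂), 𝒪_{D₁×{q}}(M₁)) = (0, 1, 2, 1, 0)`: exactly ONE gluing class at the intersection point `(p,q)`, and Euler characteristic `0`.
[new; bookkeeping] -/
theorem pgt_example_ic_ext :
    (0 : ℤ) * 1 = 0 ∧ (0 : ℤ) * 1 + 1 * 1 = 1 ∧ (0 : ℤ) * 0 + 1 * 1 + 1 * 1 = 2 ∧ (1 : ℤ) * 0 + 1 * 1 = 1 ∧ (1 : ℤ) * 0 = 0 ∧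
    (0 : ℤ) - 1 + 2 - 1 + 0 = 0 := by
  refine ⟨by norm_num, by norm_num, by norm_num, by norm_num, by norm_num, by norm_num⟩

/-- **EXAMPLE IC, the parameter count (report §11.3 (vi)).** The non-symmetric halves cost `q ∈ B₁` (2), `r ∈ B₂` (2), `(a,b) ∈ B₁ × B₂` (2 + 2),
and LEMMA IC's ratio `[η₁₁ : η₁₂]` one more: an injective `9`-dimensional family of simple ι-invariant balanced sheaves with the H2 class, so
`e₁^ι(F_λ) ≥ 9 > 1` — and `e₂^ι = 10 + 2e₁^ι ≥ 28`. [new; bookkeeping] -/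
theorem pgt_example_ic_count : (2 : ℤ) + 2 + (2 + 2) + 1 = 9 ∧ (9 : ℤ) > 1 ∧ (10 : ℤ) + 2 * 9 = 28 := by
  refine ⟨by norm_num, by norm_num, by norm_num⟩

end ProductGroundTwoAddendumTwo

end Summit.HodgeConjecture.HodgeConjecture.WeilTypeLadder
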